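import Summits.HodgeConjecture.HodgeConjecture.Theorems.NikulinTwinTransportRealMultiplicationAnchorOfAlgebraic

/-!
# `TwinTransportRMPicardTwo` (stmt-HodgeConjecture-15067) · Negative · the type clause (eT) of the
# `e`-block is load-bearing too: a RATIONAL junk `e`-block on every Picard-rank-2 K3 surface

Companion of `Negative/WithoutRationalityClause.lean` (p98771: without (eR) the `e`-block of the
crux is met by `√2 · (𝟙 − π_N)` on every projective K3 surface).  Here the other half: ON THE TREE'S
OWN CARRIERS, granted the same four named facts (markings, `N¹ ⊆ F¹`, the Hodge index theorem for
`S`, `CupPreservesHodgeType 2 S`), every projective K3 surface `S` of Picard rank `2`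
(`finrank_ℂ (algebraicClasses S 1) = 2`) carries an endomorphism `e` of `H²(S(ℂ); ℂ)` which is
RATIONAL, kills `NS := algebraicClasses S 1` and satisfies `e (e x) = 2 • x` on `NS^⊥` — clauses
(eR), (eNS), (e²) of the crux — but is not type-preserving: `exists_rational_junk_eBlock`.
Construction: read `H²` through a marking `η`; the rational points `T_ℚ` of `T = NS^⊥` have
`dim_ℚ T_ℚ = 20` (from `H² = NS ⊕ T` over `ℂ` via `exists_nsProjection`, `NS` and `T` being spanned
by rational classes, and `NS_ℚ ∩ T_ℚ = 0`), so `T_ℚ ≅ ℚ¹⁰ × ℚ¹⁰` carries `J(u,v) = (2v,u)` with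
`J² = 2`; extend `J` by zero on a complement of `T_ℚ`, complexify the resulting rational matrix, and
precompose with `𝟙 − π_N`.

Consequently the crux with (eT) DELETED (verbatim otherwise, INLINED as the hypothesis of
`atRankTwo_of_withoutET`) is EQUIVALENT, modulo the facts, to the parent crux `TwinTwistorTransport`
restricted to Picard rank `2` (INLINED as its conclusion; = the crux with the whole `e`-block
deleted): `atRankTwo_of_withoutET` / `withoutET_of_atRankTwo`.  With p98771: (eR) and (eT) are EACH
load-bearing and only JOINTLY single out the real-multiplication surfaces — any proof of the
milestone exploiting `√2 ∈ End_Hdg(T(S)_ℚ)` must use both; deleting either silently turns the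
judge's 8-dimensional RM-√2 families into all projective K3 surfaces of Picard rank 2.

Refuter seat refuter-cdisprove-stmt-HodgeConjecture-15067-0 (gen 1), 2026-08-16; work file
`Cruxes/TwinTransportRMPicardTwo/Disproof.lean` §B (shadows B2–B4).
-/

noncomputable section

namespace Summit.HodgeConjecture.HodgeConjecture.Theorems.TwinTransportRMPicardTwo.Negative

open scoped Manifold
open CategoryTheory MonoidalCategory SemiCartesianMonoidalCategory
open Literature.AlgebraicGeometry.Motives Literature.AlgebraicGeometry.HodgeTheory
open Literature.AlgebraicGeometry.Surfaces Literature.Geometry.Kaehler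
open Literature.AlgebraicTopology.SingularHomology
open Summit.HodgeConjecture.HodgeConjecture.Theorems.NikulinTwinTransport

/-- **The rational junk `e`-block.**  On every projective K3 surface `S` of Picard rank `2`, granted
markings, `N¹ ⊆ F¹`, the Hodge index theorem for `S` and `CupPreservesHodgeType 2 S`, there is an
endomorphism `e` of `H²(S(ℂ); ℂ)` which preserves rational classes, kills `NS = algebraicClasses S 1`
and satisfies `e (e x) = 2 • x` on `NS^⊥` — clauses (eR), (eNS), (e²) of the crux
`TwinTransportRMPicardTwo` — namely `e = η⁻¹ ∘ (J ⊕ 0)_ℂ ∘ η ∘ (𝟙 − π_N)` for a marking `η`, the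
projection `π_N` of `exists_nsProjection`, and `J(u,v) = (2v,u)` on `T_ℚ ≅ ℚ¹⁰ × ℚ¹⁰`.  (It is not
type-preserving: `J` does not respect the period line.)  So (eR)+(eNS)+(e²) do not restrict a
Picard-rank-2 surface at all. [folklore] -/
theorem exists_rational_junk_eBlock (hmark : Huybrechts_K3_marking_exists)
    (hG : Grothendieck1969_supportedClasses_le_hodgeConiveau) {S : SchemeOver ℂ} (hS : IsK3Surface S)
    (hHI : hodgeIndex_surface S) (hcupS : CupPreservesHodgeType 2 S)
    (hrank : Module.finrank ℂ ↥(algebraicClasses S 1) = 2) :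
    ∃ e : complexBetti S (2 * 1) →ₗ[ℂ] complexBetti S (2 * 1),
      (∀ x, IsRationalClass x → IsRationalClass (e x)) ∧
      (∀ d ∈ algebraicClasses S 1, e d = 0) ∧
      (∀ x : complexBetti S (2 * 1),
        (∀ d ∈ algebraicClasses S 1, cupProduct (rfl : 2 * 1 + 2 * 1 = 2 * 2) x d = 0) →
          e (e x) = (2 : ℂ) • x) := by
  classical
  obtain ⟨η, p₀, x₀, hp₀, ⟨-, -, hηint, hηcup, -, -⟩, -⟩ := hmark S hS
  obtain ⟨A⟩ := hS.nonempty_hodgeModel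
  have hN11 : ∀ d ∈ algebraicClasses S 1, IsOfHodgeType 2 S (2 * 1) 1 1 d :=
    fun d hd => isOfHodgeType_oneOne_of_mem_algebraicClasses hG hS hd
  obtain ⟨π, hπN, hπid, hπT, hπperp, hπrat, -⟩ :=
    exists_nsProjection hS η hp₀ hηint hηcup hHI A hcupS hN11
  haveI hfin : FiniteDimensional ℂ (complexBetti S (2 * 1)) := LinearEquiv.finiteDimensional η.symm
  set N : Submodule ℂ (complexBetti S (2 * 1)) := algebraicClasses S 1 with hNdef
  set T : Submodule ℂ (complexBetti S (2 * 1)) :=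
    LinearMap.BilinForm.orthogonal
      (k3FormC.compl₁₂ η.toLinearMap η.toLinearMap : LinearMap.BilinForm ℂ (complexBetti S (2 * 1))) N
    with hTdef
  have memT : ∀ x, x ∈ T ↔ ∀ d ∈ N, cupProduct (rfl : 2 * 1 + 2 * 1 = 2 * 2) x d = 0 :=
    mem_orthogonal_iff η hp₀ hηcup
  -- `N ∩ T = 0` and `N + T = H²` over `ℂ`
  have hNT : ∀ x ∈ N, x ∈ T → x = 0 := fun x hxN hxT => by
    rw [← hπid x hxN]
    exact hπT x ((memT x).1 hxT)
  have hinf : N ⊓ T = ⊥ := (Submodule.eq_bot_iff _).2 fun x hx => hNT x hx.1 hx.2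
  have hsup : N ⊔ T = ⊤ := Submodule.eq_top_iff'.2 fun x => by
    have h : π x + (x - π x) ∈ N ⊔ T := Submodule.add_mem_sup (hπN x) ((memT _).2 (hπperp x))
    rwa [add_sub_cancel] at h
  have hcard : Fintype.card K3Index = 22 := by simp [K3Index]
  have hV : Module.finrank ℂ (complexBetti S (2 * 1)) = 22 := by
    rw [η.finrank_eq, Module.finrank_fintype_fun_eq_card, hcard]
  have hT20 : Module.finrank ℂ T = 20 := by
    have h1 := Submodule.finrank_sup_add_finrank_inf_eq N T
    rw [hsup, hinf, finrank_top, finrank_bot, add_zero, hV, hrank] at h1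
    omega
  -- the rational points of `N` and of `T`, read through the marking
  let NQ : Submodule ℚ (K3Index → ℚ) :=
    { carrier := {u | η.symm (fun j => (u j : ℂ)) ∈ N}
      add_mem' := fun {u v} hu hv => by
        simp only [Set.mem_setOf_eq, ratCastΛ_add, map_add]
        exact N.add_mem hu hv
      zero_mem' := by
        simp only [Set.mem_setOf_eq, ratCastΛ_zero, map_zero]
        exact N.zero_mem
      smul_mem' := fun q u hu => by
        simp only [Set.mem_setOf_eq, ratCastΛ_smul, map_smul]
        exact N.smul_mem _ hu }
  have memNQ : ∀ u, u ∈ NQ ↔ η.symm (fun j => (u j : ℂ)) ∈ N := fun u => Iff.rfl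
  let TQ : Submodule ℚ (K3Index → ℚ) :=
    { carrier := {u | η.symm (fun j => (u j : ℂ)) ∈ T}
      add_mem' := fun {u v} hu hv => by
        simp only [Set.mem_setOf_eq, ratCastΛ_add, map_add]
        exact T.add_mem hu hv
      zero_mem' := by
        simp only [Set.mem_setOf_eq, ratCastΛ_zero, map_zero]
        exact T.zero_mem
      smul_mem' := fun q u hu => by
        simp only [Set.mem_setOf_eq, ratCastΛ_smul, map_smul]
        exact T.smul_mem _ hu }
  have memTQ : ∀ u, u ∈ TQ ↔ η.symm (fun j => (u j : ℂ)) ∈ T := fun u => Iff.rfl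
  -- `N_ℚ ∩ T_ℚ = 0`, so `dim N_ℚ + dim T_ℚ ≤ 22`
  have hinfQ : NQ ⊓ TQ = ⊥ := (Submodule.eq_bot_iff _).2 fun u hu => by
    have h0 : η.symm (fun j => (u j : ℂ)) = 0 := hNT _ hu.1 hu.2
    have h1 : (fun j => (u j : ℂ)) = 0 := by simpa using congrArg η h0
    exact ratCastΛ_injective (h1.trans ratCastΛ_zero.symm)
  have hsumQ : Module.finrank ℚ NQ + Module.finrank ℚ TQ ≤ 22 := by
    have h1 := Submodule.finrank_sup_add_finrank_inf_eq NQ TQ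
    rw [hinfQ, finrank_bot, add_zero] at h1
    have h2 : Module.finrank ℚ ↥(NQ ⊔ TQ) ≤ Module.finrank ℚ (K3Index → ℚ) := Submodule.finrank_le _
    rw [Module.finrank_fintype_fun_eq_card, hcard] at h2
    omega
  -- a complex subspace spanned by the images of a rational subspace has at most its dimension
  have key : ∀ (Q : Submodule ℚ (K3Index → ℚ)) (P : Submodule ℂ (complexBetti S (2 * 1))),
      P ≤ Submodule.span ℂ ((fun u : K3Index → ℚ => η.symm (fun j => (u j : ℂ))) '' (Q : Set (K3Index → ℚ))) →
        Module.finrank ℂ P ≤ Module.finrank ℚ Q := by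
    intro Q P hP
    let b := Module.finBasis ℚ Q
    let Ψ : (Fin (Module.finrank ℚ Q) → ℂ) →ₗ[ℂ] complexBetti S (2 * 1) :=
      Fintype.linearCombination ℂ fun i => η.symm (fun j => ((b i : K3Index → ℚ) j : ℂ))
    have hrange : Submodule.span ℂ ((fun u : K3Index → ℚ => η.symm (fun j => (u j : ℂ))) ''
        (Q : Set (K3Index → ℚ))) ≤ LinearMap.range Ψ := by
      rw [Submodule.span_le]
      rintro _ ⟨u, hu, rfl⟩
      refine ⟨fun i => (b.repr ⟨u, hu⟩ i : ℂ), ?_⟩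
      rw [Fintype.linearCombination_apply]
      have hu' : (u : K3Index → ℚ) = ∑ i, b.repr ⟨u, hu⟩ i • (b i : K3Index → ℚ) := by
        conv_lhs => rw [show u = ((⟨u, hu⟩ : Q) : K3Index → ℚ) from rfl, ← b.sum_repr ⟨u, hu⟩]
        rw [Submodule.coe_sum]
        rfl
      change _ = η.symm (fun j => (u j : ℂ))
      conv_rhs => rw [hu']
      rw [ratCastΛ_sum, map_sum]
      refine Finset.sum_congr rfl fun i _ => ?_
      rw [ratCastΛ_smul, map_smul]
    calc Module.finrank ℂ P ≤ Module.finrank ℂ (LinearMap.range Ψ) := Submodule.finrank_mono (hP.trans hrange)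
      _ ≤ Module.finrank ℂ (Fin (Module.finrank ℚ Q) → ℂ) := LinearMap.finrank_range_le Ψ
      _ = Module.finrank ℚ Q := Module.finrank_fin_fun ℂ
  -- `N` is spanned by the images of `N_ℚ` (it is spanned by its rational classes)
  have hNspan : N ≤ Submodule.span ℂ ((fun u : K3Index → ℚ => η.symm (fun j => (u j : ℂ))) ''
      (NQ : Set (K3Index → ℚ))) := by
    have hspan := supportedClasses_eq_span_isRationalClass hS.1 (2 * 1) 1
    intro d hd
    have hd' : d ∈ Submodule.span ℂ {c : complexBetti S (2 * 1) |
        IsRationalClass c ∧ c ∈ supportedClasses S (2 * 1) 1} := by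
      rw [← hspan]; exact hd
    refine Submodule.span_mono ?_ hd'
    rintro c ⟨hc, hcN⟩
    obtain ⟨w, hw⟩ := (isRationalClass_iff_of_marking hS η hηint c).1 hc
    refine ⟨w, ?_, ?_⟩
    · show η.symm (fun j => (w j : ℂ)) ∈ N
      rw [← hw, LinearEquiv.symm_apply_apply]; exact hcN
    · show η.symm (fun j => (w j : ℂ)) = c
      rw [← hw, LinearEquiv.symm_apply_apply]
  -- `T` is spanned by the images of `T_ℚ`
  set P' : Submodule ℂ (complexBetti S (2 * 1)) := Submodule.span ℂ
    ((fun u : K3Index → ℚ => η.symm (fun j => (u j : ℂ))) '' (TQ : Set (K3Index → ℚ))) with hP'def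
  have hP'T : P' ≤ T := by
    rw [hP'def, Submodule.span_le]
    rintro _ ⟨u, hu, rfl⟩
    exact hu
  have hNP' : N ⊔ P' = ⊤ := by
    rw [eq_top_iff, ← ((Pi.basisFun ℂ K3Index).map η.symm).span_eq, Submodule.span_le]
    rintro _ ⟨k, rfl⟩
    have hk : IsRationalClass (((Pi.basisFun ℂ K3Index).map η.symm) k) := by
      rw [Module.Basis.map_apply, basisFun_eq_ratCastΛ]
      exact (isRationalClass_iff_of_marking hS η hηint _).2 ⟨_, η.apply_symm_apply _⟩
    obtain ⟨n, t, hn, -, ht, htr, hnt⟩ := exists_mem_add_mem_of_isRationalClass hS η hηint hηcup hHI hk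
    rw [SetLike.mem_coe, hnt]
    obtain ⟨w, hw⟩ := (isRationalClass_iff_of_marking hS η hηint t).1 htr
    have htw : t = η.symm (fun j => (w j : ℂ)) := by rw [← hw, LinearEquiv.symm_apply_apply]
    refine Submodule.add_mem_sup hn (Submodule.subset_span ⟨w, ?_, htw.symm⟩)
    show η.symm (fun j => (w j : ℂ)) ∈ T
    rw [← htw]; exact (memT t).2 ht
  have hTspan : T ≤ P' := by
    intro x hxT
    have hx : x ∈ N ⊔ P' := by rw [hNP']; exact Submodule.mem_top
    obtain ⟨n, hn, q, hq, hsum⟩ := Submodule.mem_sup.1 hx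
    have hn0 : n = 0 := hNT n hn (by
      have : n = x - q := eq_sub_of_add_eq hsum
      rw [this]; exact T.sub_mem hxT (hP'T hq))
    rw [hn0, zero_add] at hsum
    rw [← hsum]; exact hq
  -- dimension count: `dim_ℚ T_ℚ = 20`
  have hTQ20 : Module.finrank ℚ TQ = 20 := by
    have h1 := key NQ N hNspan
    have h2 := key TQ T hTspan
    rw [hrank] at h1
    rw [hT20] at h2
    omega
  -- a rational `J` on `T_ℚ ≅ ℚ¹⁰ × ℚ¹⁰` with `J² = 2`: `J(u,v) = (2v, u)`
  have hTQP : Module.finrank ℚ TQ = Module.finrank ℚ ((Fin 10 → ℚ) × (Fin 10 → ℚ)) := by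
    rw [Module.finrank_prod, Module.finrank_fin_fun, hTQ20]
  let E : TQ ≃ₗ[ℚ] (Fin 10 → ℚ) × (Fin 10 → ℚ) := LinearEquiv.ofFinrankEq _ _ hTQP
  let JP : ((Fin 10 → ℚ) × (Fin 10 → ℚ)) →ₗ[ℚ] ((Fin 10 → ℚ) × (Fin 10 → ℚ)) :=
    ((2 : ℚ) • LinearMap.snd ℚ (Fin 10 → ℚ) (Fin 10 → ℚ)).prod (LinearMap.fst ℚ (Fin 10 → ℚ) (Fin 10 → ℚ))
  have hJP : ∀ z, JP (JP z) = (2 : ℚ) • z := fun z => by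
    ext <;> simp [JP, two_smul]
  let J : TQ →ₗ[ℚ] TQ := E.symm.toLinearMap ∘ₗ JP ∘ₗ E.toLinearMap
  have hJ : ∀ w : TQ, J (J w) = (2 : ℚ) • w := fun w => by
    simp only [J, LinearMap.comp_apply, LinearEquiv.coe_coe, LinearEquiv.apply_symm_apply, hJP,
      map_smul, LinearEquiv.symm_apply_apply]
  -- extend by zero on a complement of `T_ℚ` and complexify through the marking
  obtain ⟨Q', hQ'⟩ := TQ.exists_isCompl
  let eQ : (K3Index → ℚ) →ₗ[ℚ] (K3Index → ℚ) := LinearMap.ofIsCompl hQ' (TQ.subtype ∘ₗ J) 0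
  have heQ : ∀ w : TQ, eQ (w : K3Index → ℚ) = (J w : K3Index → ℚ) := fun w =>
    LinearMap.ofIsCompl_apply_left hQ' w
  let L : (K3Index → ℂ) →ₗ[ℂ] (K3Index → ℂ) :=
    Matrix.toLin' ((LinearMap.toMatrix' eQ).map (Rat.castHom ℂ))
  have hL : ∀ u : K3Index → ℚ, L (fun j => (u j : ℂ)) = fun j => (eQ u j : ℂ) := fun u => by
    funext i
    have h := RingHom.map_mulVec (Rat.castHom ℂ) (LinearMap.toMatrix' eQ) u i
    rw [LinearMap.toMatrix'_mulVec, Rat.coe_castHom] at h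
    rw [h]
    rfl
  let Ec : complexBetti S (2 * 1) →ₗ[ℂ] complexBetti S (2 * 1) :=
    η.symm.toLinearMap ∘ₗ L ∘ₗ η.toLinearMap
  have hEc : ∀ u : K3Index → ℚ, Ec (η.symm fun j => (u j : ℂ)) = η.symm fun j => (eQ u j : ℂ) :=
    fun u => by
    simp only [Ec, LinearMap.comp_apply, LinearEquiv.coe_coe, LinearEquiv.apply_symm_apply, hL]
  -- on the span `P'` of the rational transcendental classes (`= T`): `Ec` maps into `T` and squares to `2`
  have hEcP : ∀ y, y ∈ P' → Ec y ∈ T ∧ Ec (Ec y) = (2 : ℂ) • y := by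
    intro y hy'
    induction hy' using Submodule.span_induction with
    | mem y hy =>
      obtain ⟨u, hu, rfl⟩ := hy
      have hu' : u ∈ TQ := hu
      have h1 : Ec (η.symm fun j => (u j : ℂ)) = η.symm fun j => ((J ⟨u, hu'⟩ : K3Index → ℚ) j : ℂ) := by
        rw [hEc, ← heQ ⟨u, hu'⟩]
      refine ⟨?_, ?_⟩
      · rw [h1]
        exact (J ⟨u, hu'⟩).2
      · rw [h1, hEc, heQ, hJ, Submodule.coe_smul, ratCastΛ_smul, map_smul, Rat.cast_ofNat]
    | zero => exact ⟨by rw [map_zero]; exact T.zero_mem, by rw [map_zero, map_zero, smul_zero]⟩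
    | add y z _ _ hy hz =>
      exact ⟨by rw [map_add]; exact T.add_mem hy.1 hz.1,
        by rw [map_add, map_add, hy.2, hz.2, smul_add]⟩
    | smul c y _ hy =>
      exact ⟨by rw [map_smul]; exact T.smul_mem c hy.1,
        by rw [map_smul, map_smul, hy.2, smul_comm]⟩
  have hEcT : ∀ y ∈ T, Ec y ∈ T ∧ Ec (Ec y) = (2 : ℂ) • y := fun y hy => hEcP y (hTspan hy)
  -- the endomorphism `e := Ec ∘ (𝟙 - π_N)`
  refine ⟨Ec ∘ₗ (LinearMap.id - π), ?_, ?_, ?_⟩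
  · -- rationality
    intro x hx
    have hsub : IsRationalClass (x - π x) := by
      have h : x - π x = x + (((-1 : ℚ) : ℂ) • π x) := by
        rw [Rat.cast_neg, Rat.cast_one, neg_one_smul, sub_eq_add_neg]
      rw [h]
      exact hx.add ((hπrat x hx).smul (-1))
    obtain ⟨w, hw⟩ := (isRationalClass_iff_of_marking hS η hηint _).1 hsub
    have hxw : x - π x = η.symm (fun j => (w j : ℂ)) := by rw [← hw, LinearEquiv.symm_apply_apply]
    rw [LinearMap.comp_apply, LinearMap.sub_apply, LinearMap.id_apply, hxw, hEc]
    exact (isRationalClass_iff_of_marking hS η hηint _).2 ⟨eQ w, LinearEquiv.apply_symm_apply _ _⟩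
  · -- kills `N`
    intro d hd
    rw [LinearMap.comp_apply, LinearMap.sub_apply, LinearMap.id_apply, hπid d hd, sub_self, map_zero]
  · -- `e² = 2` on `N^⊥`
    intro x hx
    have hxT : x ∈ T := (memT x).2 hx
    have hex : (Ec ∘ₗ (LinearMap.id - π)) x = Ec x := by
      rw [LinearMap.comp_apply, LinearMap.sub_apply, LinearMap.id_apply, hπT x hx, sub_zero]
    obtain ⟨hExT, hEEx⟩ := hEcT x hxT
    rw [hex, LinearMap.comp_apply, LinearMap.sub_apply, LinearMap.id_apply,
      hπT _ ((memT _).1 hExT), sub_zero, hEEx]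

/-- **WITHOUT (eT) the crux is the parent crux at Picard rank 2** (the informative direction):
granted the four facts for every projective K3 surface, the crux with the type clause deleted
implies `TwinTwistorTransport` restricted to `finrank_ℂ (algebraicClasses S 1) = 2` — feed the
rational junk `e`-block of `exists_rational_junk_eBlock` to the hypothesis. [folklore] -/
theorem atRankTwo_of_withoutET (hmark : Huybrechts_K3_marking_exists)
    (hG : Grothendieck1969_supportedClasses_le_hodgeConiveau)
    (hHI : ∀ S : SchemeOver ℂ, IsK3Surface S → hodgeIndex_surface S)
    (hcupS : ∀ S : SchemeOver ℂ, IsK3Surface S → CupPreservesHodgeType 2 S)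
    (h : ∀ (μ : Literature.AlgebraicGeometry.HodgeTheory.OrientationFamily), μ.HasPoincareDuality → ∀ (S : Literature.AlgebraicGeometry.Motives.SchemeOver ℂ) (hS : (Literature.AlgebraicGeometry.Motives.IsSmoothProjective 2 S ∧ Subsingleton (Literature.AlgebraicGeometry.Motives.structureSheafCohomology S.left 1) ∧ ∃ (A : Literature.AlgebraicGeometry.HodgeTheory.HodgeModel 2 S) (η : Literature.Geometry.Kaehler.MForm 𝓘(ℝ, A.model) A.carrier ℂ 2), Literature.Geometry.Kaehler.IsHolomorphicInCharts η ∧ ∀ x, η x ≠ 0)) (p : Literature.AlgebraicGeometry.HodgeTheory.complexBetti S (2 * 2)), (Literature.AlgebraicGeometry.HodgeTheory.IsIntegralClass p ∧ ∀ q : Literature.AlgebraicGeometry.HodgeTheory.complexBetti S (2 * 2), Literature.AlgebraicGeometry.HodgeTheory.IsIntegralClass q → ∃ n : ℤ, q = n • p) → Module.finrank ℂ ↥(Literature.AlgebraicGeometry.HodgeTheory.algebraicClasses S 1) = 2 → ∀ (e : Literature.AlgebraicGeometry.HodgeTheory.complexBetti S (2 * 1) →ₗ[ℂ] Literature.AlgebraicGeometry.HodgeTheory.complexBetti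 S (2 * 1)), (∀ x, Literature.AlgebraicGeometry.HodgeTheory.IsRationalClass x → Literature.AlgebraicGeometry.HodgeTheory.IsRationalClass (e x)) → (∀ d ∈ Literature.AlgebraicGeometry.HodgeTheory.algebraicClasses S 1, e d = 0) → (∀ x : Literature.AlgebraicGeometry.HodgeTheory.complexBetti S (2 * 1), (∀ d ∈ Literature.AlgebraicGeometry.HodgeTheory.algebraicClasses S 1, Literature.AlgebraicTopology.SingularHomology.cupProduct (rfl : 2 * 1 + 2 * 1 = 2 * 2) x d = 0) → e (e x) = (2 : ℂ) • x) → ∃ (S'' : Literature.AlgebraicGeometry.Motives.SchemeOver ℂ) (hS'' : (Literature.AlgebraicGeometry.Motives.IsSmoothProjective 2 S'' ∧ Subsingleton (Literature.AlgebraicGeometry.Motives.structureSheafCohomology S''.left 1) ∧ ∃ (A : Literature.AlgebraicGeometry.HodgeTheory.HodgeModel 2 S'') (η : Literature.Geometry.Kaehler.MForm 𝓘(ℝ, A.model) A.carrier ℂ 2), Literature.Geometry.Kaehler.IsHolomorphicInCharts η ∧ ∀ x, η x ≠ 0)) (p'' : Literature.AlgebraicGeometry.HodgeTheory.complexBetti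 S'' (2 * 2)), (Literature.AlgebraicGeometry.HodgeTheory.IsIntegralClass p'' ∧ ∀ q : Literature.AlgebraicGeometry.HodgeTheory.complexBetti S'' (2 * 2), Literature.AlgebraicGeometry.HodgeTheory.IsIntegralClass q → ∃ n : ℤ, q = n • p'') ∧ ∃ Ψ : Literature.AlgebraicGeometry.HodgeTheory.complexBetti S'' (2 * 1) ≃ₗ[ℂ] Literature.AlgebraicGeometry.HodgeTheory.complexBetti S (2 * 1), (∀ y, Literature.AlgebraicGeometry.HodgeTheory.IsRationalClass y → Literature.AlgebraicGeometry.HodgeTheory.IsRationalClass (Ψ.symm y)) ∧ (∀ (i j : ℕ) y, Literature.AlgebraicGeometry.HodgeTheory.IsOfHodgeType 2 S (2 * 1) i j y → Literature.AlgebraicGeometry.HodgeTheory.IsOfHodgeType 2 S'' (2 * 1) i j (Ψ.symm y)) ∧ (∀ (u v : Literature.AlgebraicGeometry.HodgeTheory.complexBetti S (2 * 1)) (b : ℂ), Literature.AlgebraicTopology.SingularHomology.cupProduct (rfl : 2 * 1 + 2 * 1 = 2 * 2) u v = ((2 : ℂ) * b) • p → Literature.AlgebraicTopology.SingularHomology.cupProduct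 (rfl : 2 * 1 + 2 * 1 = 2 * 2) (Ψ.symm u) (Ψ.symm v) = b • p'') ∧ ∃ γ ∈ Literature.AlgebraicGeometry.HodgeTheory.algebraicClasses (CategoryTheory.MonoidalCategoryStruct.tensorObj S S'') 2, ∀ x : Literature.AlgebraicGeometry.HodgeTheory.complexBetti S'' (2 * 1), Ψ x = Literature.AlgebraicGeometry.HodgeTheory.complexGysin μ (Literature.AlgebraicGeometry.Motives.IsSmoothProjective.tensor_holds hS.1 hS''.1) hS.1 (CategoryTheory.SemiCartesianMonoidalCategory.fst S S'') (rfl : 2 * 1 + 2 * 2 + 2 * 2 = 2 * 1 + 2 * (2 + 2)) (Literature.AlgebraicTopology.SingularHomology.cupProduct (rfl : 2 * 1 + 2 * 2 = 2 * 1 + 2 * 2) (Literature.AlgebraicGeometry.HodgeTheory.complexBetti.map (CategoryTheory.SemiCartesianMonoidalCategory.snd S S'') (2 * 1) x) γ)) :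
    ∀ (μ : Literature.AlgebraicGeometry.HodgeTheory.OrientationFamily), μ.HasPoincareDuality → ∀ (S : Literature.AlgebraicGeometry.Motives.SchemeOver ℂ) (hS : (Literature.AlgebraicGeometry.Motives.IsSmoothProjective 2 S ∧ Subsingleton (Literature.AlgebraicGeometry.Motives.structureSheafCohomology S.left 1) ∧ ∃ (A : Literature.AlgebraicGeometry.HodgeTheory.HodgeModel 2 S) (η : Literature.Geometry.Kaehler.MForm 𝓘(ℝ, A.model) A.carrier ℂ 2), Literature.Geometry.Kaehler.IsHolomorphicInCharts η ∧ ∀ x, η x ≠ 0)) (p : Literature.AlgebraicGeometry.HodgeTheory.complexBetti S (2 * 2)), (Literature.AlgebraicGeometry.HodgeTheory.IsIntegralClass p ∧ ∀ q : Literature.AlgebraicGeometry.HodgeTheory.complexBetti S (2 * 2), Literature.AlgebraicGeometry.HodgeTheory.IsIntegralClass q → ∃ n : ℤ, q = n • p) → Module.finrank ℂ ↥(Literature.AlgebraicGeometry.HodgeTheory.algebraicClasses S 1) = 2 → ∃ (S'' : Literature.AlgebraicGeometry.Motives.SchemeOver ℂ) (hS'' : (Literature.AlgebraicGeometry.Motives.IsSmoothProjective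 2 S'' ∧ Subsingleton (Literature.AlgebraicGeometry.Motives.structureSheafCohomology S''.left 1) ∧ ∃ (A : Literature.AlgebraicGeometry.HodgeTheory.HodgeModel 2 S'') (η : Literature.Geometry.Kaehler.MForm 𝓘(ℝ, A.model) A.carrier ℂ 2), Literature.Geometry.Kaehler.IsHolomorphicInCharts η ∧ ∀ x, η x ≠ 0)) (p'' : Literature.AlgebraicGeometry.HodgeTheory.complexBetti S'' (2 * 2)), (Literature.AlgebraicGeometry.HodgeTheory.IsIntegralClass p'' ∧ ∀ q : Literature.AlgebraicGeometry.HodgeTheory.complexBetti S'' (2 * 2), Literature.AlgebraicGeometry.HodgeTheory.IsIntegralClass q → ∃ n : ℤ, q = n • p'') ∧ ∃ Ψ : Literature.AlgebraicGeometry.HodgeTheory.complexBetti S'' (2 * 1) ≃ₗ[ℂ] Literature.AlgebraicGeometry.HodgeTheory.complexBetti S (2 * 1), (∀ y, Literature.AlgebraicGeometry.HodgeTheory.IsRationalClass y → Literature.AlgebraicGeometry.HodgeTheory.IsRationalClass (Ψ.symm y)) ∧ (∀ (i j : ℕ) y, Literature.AlgebraicGeometry.HodgeTheory.IsOfHodgeType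 2 S (2 * 1) i j y → Literature.AlgebraicGeometry.HodgeTheory.IsOfHodgeType 2 S'' (2 * 1) i j (Ψ.symm y)) ∧ (∀ (u v : Literature.AlgebraicGeometry.HodgeTheory.complexBetti S (2 * 1)) (b : ℂ), Literature.AlgebraicTopology.SingularHomology.cupProduct (rfl : 2 * 1 + 2 * 1 = 2 * 2) u v = ((2 : ℂ) * b) • p → Literature.AlgebraicTopology.SingularHomology.cupProduct (rfl : 2 * 1 + 2 * 1 = 2 * 2) (Ψ.symm u) (Ψ.symm v) = b • p'') ∧ ∃ γ ∈ Literature.AlgebraicGeometry.HodgeTheory.algebraicClasses (CategoryTheory.MonoidalCategoryStruct.tensorObj S S'') 2, ∀ x : Literature.AlgebraicGeometry.HodgeTheory.complexBetti S'' (2 * 1), Ψ x = Literature.AlgebraicGeometry.HodgeTheory.complexGysin μ (Literature.AlgebraicGeometry.Motives.IsSmoothProjective.tensor_holds hS.1 hS''.1) hS.1 (CategoryTheory.SemiCartesianMonoidalCategory.fst S S'') (rfl : 2 * 1 + 2 * 2 + 2 * 2 = 2 * 1 + 2 * (2 + 2)) (Literature.AlgebraicTopology.SingularHomology.cupProduct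 (rfl : 2 * 1 + 2 * 2 = 2 * 1 + 2 * 2) (Literature.AlgebraicGeometry.HodgeTheory.complexBetti.map (CategoryTheory.SemiCartesianMonoidalCategory.snd S S'') (2 * 1) x) γ) := by
  intro μ hμ S hS p hp hrank
  obtain ⟨e, he_rat, he_N, he_T⟩ := exists_rational_junk_eBlock hmark hG hS (hHI S hS) (hcupS S hS) hrank
  exact h μ hμ S hS p hp hrank e he_rat he_N he_T

/-- The converse direction is bookkeeping: the parent crux at rank 2 ignores `e`. [folklore] -/
theorem withoutET_of_atRankTwo
    (h : ∀ (μ : Literature.AlgebraicGeometry.HodgeTheory.OrientationFamily), μ.HasPoincareDuality → ∀ (S : Literature.AlgebraicGeometry.Motives.SchemeOver ℂ) (hS : (Literature.AlgebraicGeometry.Motives.IsSmoothProjective 2 S ∧ Subsingleton (Literature.AlgebraicGeometry.Motives.structureSheafCohomology S.left 1) ∧ ∃ (A : Literature.AlgebraicGeometry.HodgeTheory.HodgeModel 2 S) (η : Literature.Geometry.Kaehler.MForm 𝓘(ℝ, A.model) A.carrier ℂ 2), Literature.Geometry.Kaehler.IsHolomorphicInCharts η ∧ ∀ x, η x ≠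 0)) (p : Literature.AlgebraicGeometry.HodgeTheory.complexBetti S (2 * 2)), (Literature.AlgebraicGeometry.HodgeTheory.IsIntegralClass p ∧ ∀ q : Literature.AlgebraicGeometry.HodgeTheory.complexBetti S (2 * 2), Literature.AlgebraicGeometry.HodgeTheory.IsIntegralClass q → ∃ n : ℤ, q = n • p) → Module.finrank ℂ ↥(Literature.AlgebraicGeometry.HodgeTheory.algebraicClasses S 1) = 2 → ∃ (S'' : Literature.AlgebraicGeometry.Motives.SchemeOver ℂ) (hS'' : (Literature.AlgebraicGeometry.Motives.IsSmoothProjective 2 S'' ∧ Subsingleton (Literature.AlgebraicGeometry.Motives.structureSheafCohomology S''.left 1) ∧ ∃ (A : Literature.AlgebraicGeometry.HodgeTheory.HodgeModel 2 S'') (η : Literature.Geometry.Kaehler.MForm 𝓘(ℝ, A.model) A.carrier ℂ 2), Literature.Geometry.Kaehler.IsHolomorphicInCharts η ∧ ∀ x, η x ≠ 0)) (p'' : Literature.AlgebraicGeometry.HodgeTheory.complexBetti S'' (2 * 2)), (Literature.AlgebraicGeometry.HodgeTheory.IsIntegralClass p'' ∧ ∀ q : Literature.AlgebraicGeometry.HodgeTheory.complexBetti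 S'' (2 * 2), Literature.AlgebraicGeometry.HodgeTheory.IsIntegralClass q → ∃ n : ℤ, q = n • p'') ∧ ∃ Ψ : Literature.AlgebraicGeometry.HodgeTheory.complexBetti S'' (2 * 1) ≃ₗ[ℂ] Literature.AlgebraicGeometry.HodgeTheory.complexBetti S (2 * 1), (∀ y, Literature.AlgebraicGeometry.HodgeTheory.IsRationalClass y → Literature.AlgebraicGeometry.HodgeTheory.IsRationalClass (Ψ.symm y)) ∧ (∀ (i j : ℕ) y, Literature.AlgebraicGeometry.HodgeTheory.IsOfHodgeType 2 S (2 * 1) i j y → Literature.AlgebraicGeometry.HodgeTheory.IsOfHodgeType 2 S'' (2 * 1) i j (Ψ.symm y)) ∧ (∀ (u v : Literature.AlgebraicGeometry.HodgeTheory.complexBetti S (2 * 1)) (b : ℂ), Literature.AlgebraicTopology.SingularHomology.cupProduct (rfl : 2 * 1 + 2 * 1 = 2 * 2) u v = ((2 : ℂ) * b) • p → Literature.AlgebraicTopology.SingularHomology.cupProduct (rfl : 2 * 1 + 2 * 1 = 2 * 2) (Ψ.symm u) (Ψ.symm v) = b • p'') ∧ ∃ γ ∈ Literature.AlgebraicGeometry.HodgeTheory.algebraicClasses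 (CategoryTheory.MonoidalCategoryStruct.tensorObj S S'') 2, ∀ x : Literature.AlgebraicGeometry.HodgeTheory.complexBetti S'' (2 * 1), Ψ x = Literature.AlgebraicGeometry.HodgeTheory.complexGysin μ (Literature.AlgebraicGeometry.Motives.IsSmoothProjective.tensor_holds hS.1 hS''.1) hS.1 (CategoryTheory.SemiCartesianMonoidalCategory.fst S S'') (rfl : 2 * 1 + 2 * 2 + 2 * 2 = 2 * 1 + 2 * (2 + 2)) (Literature.AlgebraicTopology.SingularHomology.cupProduct (rfl : 2 * 1 + 2 * 2 = 2 * 1 + 2 * 2) (Literature.AlgebraicGeometry.HodgeTheory.complexBetti.map (CategoryTheory.SemiCartesianMonoidalCategory.snd S S'') (2 * 1) x) γ)) :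
    ∀ (μ : Literature.AlgebraicGeometry.HodgeTheory.OrientationFamily), μ.HasPoincareDuality → ∀ (S : Literature.AlgebraicGeometry.Motives.SchemeOver ℂ) (hS : (Literature.AlgebraicGeometry.Motives.IsSmoothProjective 2 S ∧ Subsingleton (Literature.AlgebraicGeometry.Motives.structureSheafCohomology S.left 1) ∧ ∃ (A : Literature.AlgebraicGeometry.HodgeTheory.HodgeModel 2 S) (η : Literature.Geometry.Kaehler.MForm 𝓘(ℝ, A.model) A.carrier ℂ 2), Literature.Geometry.Kaehler.IsHolomorphicInCharts η ∧ ∀ x, η x ≠ 0)) (p : Literature.AlgebraicGeometry.HodgeTheory.complexBetti S (2 * 2)), (Literature.AlgebraicGeometry.HodgeTheory.IsIntegralClass p ∧ ∀ q : Literature.AlgebraicGeometry.HodgeTheory.complexBetti S (2 * 2), Literature.AlgebraicGeometry.HodgeTheory.IsIntegralClass q → ∃ n : ℤ, q = n • p) → Module.finrank ℂ ↥(Literature.AlgebraicGeometry.HodgeTheory.algebraicClasses S 1) = 2 → ∀ (e : Literature.AlgebraicGeometry.HodgeTheory.complexBetti S (2 * 1) →ₗ[ℂ] Literature.AlgebraicGeometry.HodgeTheory.complexBetti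 S (2 * 1)), (∀ x, Literature.AlgebraicGeometry.HodgeTheory.IsRationalClass x → Literature.AlgebraicGeometry.HodgeTheory.IsRationalClass (e x)) → (∀ d ∈ Literature.AlgebraicGeometry.HodgeTheory.algebraicClasses S 1, e d = 0) → (∀ x : Literature.AlgebraicGeometry.HodgeTheory.complexBetti S (2 * 1), (∀ d ∈ Literature.AlgebraicGeometry.HodgeTheory.algebraicClasses S 1, Literature.AlgebraicTopology.SingularHomology.cupProduct (rfl : 2 * 1 + 2 * 1 = 2 * 2) x d = 0) → e (e x) = (2 : ℂ) • x) → ∃ (S'' : Literature.AlgebraicGeometry.Motives.SchemeOver ℂ) (hS'' : (Literature.AlgebraicGeometry.Motives.IsSmoothProjective 2 S'' ∧ Subsingleton (Literature.AlgebraicGeometry.Motives.structureSheafCohomology S''.left 1) ∧ ∃ (A : Literature.AlgebraicGeometry.HodgeTheory.HodgeModel 2 S'') (η : Literature.Geometry.Kaehler.MForm 𝓘(ℝ, A.model) A.carrier ℂ 2), Literature.Geometry.Kaehler.IsHolomorphicInCharts η ∧ ∀ x, η x ≠ 0)) (p'' : Literature.AlgebraicGeometry.HodgeTheory.complexBetti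 S'' (2 * 2)), (Literature.AlgebraicGeometry.HodgeTheory.IsIntegralClass p'' ∧ ∀ q : Literature.AlgebraicGeometry.HodgeTheory.complexBetti S'' (2 * 2), Literature.AlgebraicGeometry.HodgeTheory.IsIntegralClass q → ∃ n : ℤ, q = n • p'') ∧ ∃ Ψ : Literature.AlgebraicGeometry.HodgeTheory.complexBetti S'' (2 * 1) ≃ₗ[ℂ] Literature.AlgebraicGeometry.HodgeTheory.complexBetti S (2 * 1), (∀ y, Literature.AlgebraicGeometry.HodgeTheory.IsRationalClass y → Literature.AlgebraicGeometry.HodgeTheory.IsRationalClass (Ψ.symm y)) ∧ (∀ (i j : ℕ) y, Literature.AlgebraicGeometry.HodgeTheory.IsOfHodgeType 2 S (2 * 1) i j y → Literature.AlgebraicGeometry.HodgeTheory.IsOfHodgeType 2 S'' (2 * 1) i j (Ψ.symm y)) ∧ (∀ (u v : Literature.AlgebraicGeometry.HodgeTheory.complexBetti S (2 * 1)) (b : ℂ), Literature.AlgebraicTopology.SingularHomology.cupProduct (rfl : 2 * 1 + 2 * 1 = 2 * 2) u v = ((2 : ℂ) * b) • p → Literature.AlgebraicTopology.SingularHomology.cupProduct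 (rfl : 2 * 1 + 2 * 1 = 2 * 2) (Ψ.symm u) (Ψ.symm v) = b • p'') ∧ ∃ γ ∈ Literature.AlgebraicGeometry.HodgeTheory.algebraicClasses (CategoryTheory.MonoidalCategoryStruct.tensorObj S S'') 2, ∀ x : Literature.AlgebraicGeometry.HodgeTheory.complexBetti S'' (2 * 1), Ψ x = Literature.AlgebraicGeometry.HodgeTheory.complexGysin μ (Literature.AlgebraicGeometry.Motives.IsSmoothProjective.tensor_holds hS.1 hS''.1) hS.1 (CategoryTheory.SemiCartesianMonoidalCategory.fst S S'') (rfl : 2 * 1 + 2 * 2 + 2 * 2 = 2 * 1 + 2 * (2 + 2)) (Literature.AlgebraicTopology.SingularHomology.cupProduct (rfl : 2 * 1 + 2 * 2 = 2 * 1 + 2 * 2) (Literature.AlgebraicGeometry.HodgeTheory.complexBetti.map (CategoryTheory.SemiCartesianMonoidalCategory.snd S S'') (2 * 1) x) γ) :=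
  fun μ hμ S hS p hp hrank _ _ _ _ => h μ hμ S hS p hp hrank

end Summit.HodgeConjecture.HodgeConjecture.Theorems.TwinTransportRMPicardTwo.Negative

end
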